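import Summits.CriticalPhenomena.PercolationContinuityZ3.Theorems.PercNearOneGluingNoHeavyLowerTailQuantitativeS5Rigidity
import Summits.CriticalPhenomena.PercolationContinuityZ3.Theorems.PercNearOneGluingNoHeavyLowerTailQuantitativeS5PatternTransfer
import HarnessLib

/-!
# The FIRST-RANKED relay: a functional-free strictness certificate for the surplus transfer (S5)

Support file (`--supports stmt-CriticalPhenomena-4575`), prover seat `prim-rate-mine-2` (lane prim-rate, constants-miner (c), BENCH rows
M2-R31 / M2-R32; `run/shared/lean/prim/prim-rate/prim-rate-mine-2/PROOFS.md` §P30–§P31).  No definitions, no named facts, no sorries;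
standard axioms.

Let `x₁` be the `r`-minimal relay of `T` and `G₁ = 1{x₁ ∈ ·}` its connection functional (monotone, but ANTI-compatible with `r`:
`m_{x₁}(G₁) = 1`).  With the first-in-rank patterns `P^u_a = {u ↔ a} ∩ ⋂_{r t < r a}{u ↮ t}` of `CSH.surplus`:

* `CSH.surplus_connFun_firstRelay` — **`Sur_u(T)[G₁] = − Σ_{a ∈ T ∖ x₁} μ(P^u_a) · μ(a ↔ x₁)`** (exact);
* `CSH.s5dMargin_nil_connFun_firstRelay_nonpos` — by PATTERN TRANSFER (`CSH.pattern_transfer`, row M2-R32) every summand of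
  `margin[G₁] = − Σ_{a ≠ x₁} μ(a ↔ x₁)·(μ(P^o_a) − p·μ(P^v_a))`, `p = μ(o ↔ v | v ↮ T)`, is `≤ 0`: **`s5dMargin w T r [] o v G₁ ≤ 0`** — the first
  relay's connection functional is ALWAYS a non-positive direction of the (S5) functional;
* `CSH.s5dMargin_nil_connFun_firstRelay_neg` — it is a NEGATIVE direction as soon as one relay `a ≠ x₁` has `μ(a ↔ x₁) > 0` and a STRICT
  pattern transfer `μ(v ↮ T, o ↔ v)·μ(P^v_a) < μ(v ↮ T)·μ(P^o_a)`;
* `CSH.s5dMargin_nil_pos_of_firstRelay_certificate` — hence, by the RIGIDITY theorem (`CSH.s5dMargin_nil_pos_of_strictCompat_of_neg`, row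
  M2-R31), under that explicit, functional-free condition **(S5) is STRICT at `r` for EVERY monotone `F` with which `r` is strictly compatible**.
[cite: KozmaNitzan2024, Conj. 4 (p. 32)] [cite: VandenbergHaggstromKahn2005, Thm. 1.3 (p. 6)]
-/

noncomputable section

namespace Summit.CriticalPhenomena.PercolationContinuityZ3.Theorems

open MeasureTheory Set Literature.Probability.LatticeModels Literature.Probability.Percolation
open scoped Classical

namespace CSH

variable {n : ℕ}

/-- The connection functional of `x₁` read on a cluster is the indicator of `{c ↔ x₁}`. [folklore] -/
theorem connFun_openCluster_eq_indicator (x₁ c : Fin n) (ω : BondConfig (Fin n)) :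
    (fun S : Set (Fin n) => if x₁ ∈ S then (1 : ℝ) else 0) (openCluster ω c) = (openConn c x₁ : Set (BondConfig (Fin n))).indicator 1 ω := by
  simp only [openCluster, mem_setOf_eq]
  by_cases h : (openGraph ω).Reachable c x₁
  · rw [if_pos h, indicator_of_mem (show ω ∈ (openConn c x₁ : Set (BondConfig (Fin n))) from h), Pi.one_apply]
  · rw [if_neg h, indicator_of_notMem (show ω ∉ (openConn c x₁ : Set (BondConfig (Fin n))) from h)]

/-- **The surplus of the first-ranked relay's connection functional.**  If `x₁ ∈ T` is `r`-minimal (`r x₁ ≤ r t` on `T`), then for every `u`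
`Sur_u(T)[1{x₁ ∈ ·}] = − Σ_{a ∈ T ∖ x₁} μ(P^u_a)·μ(a ↔ x₁)`. [cite: KozmaNitzan2024, Conj. 4 (p. 32)] -/
theorem surplus_connFun_firstRelay (w : Sym2 (Fin n) → unitInterval) (T : Finset (Fin n)) (r : Fin n → ℕ) (x₁ : Fin n)
    (hx : x₁ ∈ T) (hmin : ∀ t ∈ T, r x₁ ≤ r t) (u : Fin n) :
    surplus w T r (fun S : Set (Fin n) => if x₁ ∈ S then (1 : ℝ) else 0) u =
      - ∑ a ∈ T.erase x₁, (prodBernoulli w).real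
            (openConn u a ∩ ⋂ a' ∈ T.filter (fun a' => r a' < r a), (openConn u a')ᶜ : Set (BondConfig (Fin n))) *
          (prodBernoulli w).real (openConn a x₁) := by
  have hmeas : ∀ S : Set (BondConfig (Fin n)), MeasurableSet S := fun _ => MeasurableSet.of_discrete
  -- the integrals of the functional
  have hset : ∫ ω in (⋃ a ∈ T, openConn u a), (fun S : Set (Fin n) => if x₁ ∈ S then (1 : ℝ) else 0) (openCluster ω u) ∂(prodBernoulli w) =
      (prodBernoulli w).real (openConn u x₁) := by
    simp_rw [connFun_openCluster_eq_indicator]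
    rw [KNPreFKG.setIntegral_indicator_one_eq (prodBernoulli w) _ _]
    congr 1
    refine Set.ext fun ω => ⟨fun h => h.2, fun h => ⟨?_, h⟩⟩
    exact mem_biUnion (Finset.mem_coe.2 hx) h
  have hmean : ∀ a : Fin n, ∫ ω, (fun S : Set (Fin n) => if x₁ ∈ S then (1 : ℝ) else 0) (openCluster ω a) ∂(prodBernoulli w) = (prodBernoulli w).real (openConn a x₁) := by
    intro a
    simp_rw [connFun_openCluster_eq_indicator]
    exact integral_indicator_one (hmeas _)
  have hmean1 : (prodBernoulli w).real (openConn x₁ x₁ : Set (BondConfig (Fin n))) = 1 := by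
    have : (openConn x₁ x₁ : Set (BondConfig (Fin n))) = univ := Set.ext fun ω => ⟨fun _ => trivial, fun _ => SimpleGraph.Reachable.refl _⟩
    rw [this, probReal_univ]
  -- the pattern of the minimal relay is `{u ↔ x₁}`
  have hfilt : T.filter (fun a' => r a' < r x₁) = ∅ :=
    Finset.filter_eq_empty_iff.2 fun a ha h => absurd h (not_lt.2 (hmin a ha))
  have hpat1 : (openConn u x₁ ∩ ⋂ a' ∈ T.filter (fun a' => r a' < r x₁), (openConn u a')ᶜ : Set (BondConfig (Fin n))) = openConn u x₁ := by
    rw [hfilt]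
    simp
  have hmean' : ∀ a : Fin n, ∫ ω, (if x₁ ∈ openCluster ω a then (1 : ℝ) else 0) ∂(prodBernoulli w) = (prodBernoulli w).real (openConn a x₁) :=
    fun a => hmean a
  unfold surplus
  rw [hset, ← Finset.add_sum_erase T _ hx]
  simp only [hmean']
  rw [hpat1, hmean1, mul_one]
  ring

/-- **The first relay's connection functional is a non-positive direction of (S5).**  Any weights with `μ(v ↮ T) > 0`, `v ∉ T`, any rank `r`
with an `r`-minimal relay `x₁ ∈ T`:  `s5dMargin w T r [] o v 1{x₁ ∈ ·} ≤ 0`  (pattern transfer, summand by summand).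
[cite: KozmaNitzan2024, Conj. 4 (p. 32)] [cite: VandenbergHaggstromKahn2005, Thm. 1.3 (p. 6)] -/
theorem s5dMargin_nil_connFun_firstRelay_nonpos (w : Sym2 (Fin n) → unitInterval) (T : Finset (Fin n)) (r : Fin n → ℕ)
    (x₁ : Fin n) (hx : x₁ ∈ T) (hmin : ∀ t ∈ T, r x₁ ≤ r t) (o v : Fin n) (hvT : v ∉ T)
    (hpos : 0 < (prodBernoulli w).real {ω : BondConfig (Fin n) | ∀ a ∈ T, ¬ (openGraph ω).Reachable v a}) :
    s5dMargin w T r [] o v (fun S : Set (Fin n) => if x₁ ∈ S then (1 : ℝ) else 0) ≤ 0 := by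
  set μ := prodBernoulli w with hμ
  rw [s5dMargin_nil]
  simp only [Finset.mem_coe]
  rw [surplus_connFun_firstRelay w T r x₁ hx hmin o, surplus_connFun_firstRelay w T r x₁ hx hmin v]
  set μ0 := μ.real {ω : BondConfig (Fin n) | ∀ a ∈ T, ¬ (openGraph ω).Reachable v a} with hμ0
  set μ1 := μ.real ({ω : BondConfig (Fin n) | ∀ a ∈ T, ¬ (openGraph ω).Reachable v a} ∩ openConn o v) with hμ1
  rw [mul_neg, neg_sub_neg, Finset.mul_sum, ← Finset.sum_sub_distrib]
  refine Finset.sum_nonpos fun a _ => ?_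
  have hpt := pattern_transfer w T r a o v hvT
  have hq : μ1 / μ0 * μ.real (openConn v a ∩ ⋂ t ∈ T.filter (fun t => r t < r a), (openConn v t)ᶜ : Set (BondConfig (Fin n))) ≤
      μ.real (openConn o a ∩ ⋂ t ∈ T.filter (fun t => r t < r a), (openConn o t)ᶜ : Set (BondConfig (Fin n))) := by
    rw [div_mul_eq_mul_div]
    exact (div_le_iff₀ hpos).2 (by linarith)
  have hm : 0 ≤ μ.real (openConn a x₁ : Set (BondConfig (Fin n))) := measureReal_nonneg
  nlinarith

/-- **… and a NEGATIVE direction under a strict pattern transfer.**  If moreover some relay `a ∈ T`, `a ≠ x₁`, has `μ(a ↔ x₁) > 0` and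
`μ(v ↮ T, o ↔ v)·μ(P^v_a) < μ(v ↮ T)·μ(P^o_a)`, then `s5dMargin w T r [] o v 1{x₁ ∈ ·} < 0`.
[cite: KozmaNitzan2024, Conj. 4 (p. 32)] [cite: VandenbergHaggstromKahn2005, Thm. 1.3 (p. 6)] -/
theorem s5dMargin_nil_connFun_firstRelay_neg (w : Sym2 (Fin n) → unitInterval) (T : Finset (Fin n)) (r : Fin n → ℕ)
    (x₁ : Fin n) (hx : x₁ ∈ T) (hmin : ∀ t ∈ T, r x₁ ≤ r t) (o v : Fin n) (hvT : v ∉ T)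
    (hpos : 0 < (prodBernoulli w).real {ω : BondConfig (Fin n) | ∀ a ∈ T, ¬ (openGraph ω).Reachable v a})
    (a : Fin n) (ha : a ∈ T) (hax : a ≠ x₁) (hm : 0 < (prodBernoulli w).real (openConn a x₁ : Set (BondConfig (Fin n))))
    (hstrict : (prodBernoulli w).real ({ω : BondConfig (Fin n) | ∀ t ∈ T, ¬ (openGraph ω).Reachable v t} ∩ openConn o v) *
        (prodBernoulli w).real (openConn v a ∩ ⋂ t ∈ T.filter (fun t => r t < r a), (openConn v t)ᶜ : Set (BondConfig (Fin n))) <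
      (prodBernoulli w).real {ω : BondConfig (Fin n) | ∀ t ∈ T, ¬ (openGraph ω).Reachable v t} *
        (prodBernoulli w).real (openConn o a ∩ ⋂ t ∈ T.filter (fun t => r t < r a), (openConn o t)ᶜ : Set (BondConfig (Fin n)))) :
    s5dMargin w T r [] o v (fun S : Set (Fin n) => if x₁ ∈ S then (1 : ℝ) else 0) < 0 := by
  set μ := prodBernoulli w with hμ
  rw [s5dMargin_nil]
  simp only [Finset.mem_coe]
  rw [surplus_connFun_firstRelay w T r x₁ hx hmin o, surplus_connFun_firstRelay w T r x₁ hx hmin v]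
  set μ0 := μ.real {ω : BondConfig (Fin n) | ∀ a ∈ T, ¬ (openGraph ω).Reachable v a} with hμ0
  set μ1 := μ.real ({ω : BondConfig (Fin n) | ∀ a ∈ T, ¬ (openGraph ω).Reachable v a} ∩ openConn o v) with hμ1
  rw [mul_neg, neg_sub_neg, Finset.mul_sum, ← Finset.sum_sub_distrib, ← neg_pos, ← Finset.sum_neg_distrib]
  refine Finset.sum_pos' (fun t _ => ?_) ⟨a, Finset.mem_erase.2 ⟨hax, ha⟩, ?_⟩
  · have hpt := pattern_transfer w T r t o v hvT
    have hq : μ1 / μ0 * μ.real (openConn v t ∩ ⋂ t' ∈ T.filter (fun t' => r t' < r t), (openConn v t')ᶜ : Set (BondConfig (Fin n))) ≤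
        μ.real (openConn o t ∩ ⋂ t' ∈ T.filter (fun t' => r t' < r t), (openConn o t')ᶜ : Set (BondConfig (Fin n))) := by
      rw [div_mul_eq_mul_div]
      exact (div_le_iff₀ hpos).2 (by linarith)
    have hmt : 0 ≤ μ.real (openConn t x₁ : Set (BondConfig (Fin n))) := measureReal_nonneg
    nlinarith
  · have hq : μ1 / μ0 * μ.real (openConn v a ∩ ⋂ t ∈ T.filter (fun t => r t < r a), (openConn v t)ᶜ : Set (BondConfig (Fin n))) <
        μ.real (openConn o a ∩ ⋂ t ∈ T.filter (fun t => r t < r a), (openConn o t)ᶜ : Set (BondConfig (Fin n))) := by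
      rw [div_mul_eq_mul_div]
      exact (div_lt_iff₀ hpos).2 (by linarith)
    nlinarith

/-- **The first-relay certificate: functional-free STRICTNESS of (S5).**  Any weights with `μ(v ↮ T) > 0`; `v ∉ T`; `r` injective on `T` with
minimal relay `x₁`; a relay `a ≠ x₁` with `μ(a ↔ x₁) > 0` and a strict pattern transfer `μ(v ↮ T, o ↔ v)·μ(P^v_a) < μ(v ↮ T)·μ(P^o_a)`.
Then `0 < s5dMargin w T r [] o v F` for EVERY monotone `F` with which `r` is strictly compatible (rigidity, row M2-R31, applied to the negative
direction `1{x₁ ∈ ·}`). [cite: KozmaNitzan2024, Conj. 4 (p. 32)] [cite: VandenbergHaggstromKahn2005, Thm. 1.3 (p. 6)] -/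
theorem s5dMargin_nil_pos_of_firstRelay_certificate (w : Sym2 (Fin n) → unitInterval) (T : Finset (Fin n)) (r : Fin n → ℕ)
    (x₁ : Fin n) (hx : x₁ ∈ T) (hmin : ∀ t ∈ T, r x₁ ≤ r t) (o v : Fin n) (hvT : v ∉ T) (hr : Set.InjOn r ↑T)
    (hpos : 0 < (prodBernoulli w).real {ω : BondConfig (Fin n) | ∀ a ∈ T, ¬ (openGraph ω).Reachable v a})
    (a : Fin n) (ha : a ∈ T) (hax : a ≠ x₁) (hm : 0 < (prodBernoulli w).real (openConn a x₁ : Set (BondConfig (Fin n))))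
    (hstrict : (prodBernoulli w).real ({ω : BondConfig (Fin n) | ∀ t ∈ T, ¬ (openGraph ω).Reachable v t} ∩ openConn o v) *
        (prodBernoulli w).real (openConn v a ∩ ⋂ t ∈ T.filter (fun t => r t < r a), (openConn v t)ᶜ : Set (BondConfig (Fin n))) <
      (prodBernoulli w).real {ω : BondConfig (Fin n) | ∀ t ∈ T, ¬ (openGraph ω).Reachable v t} *
        (prodBernoulli w).real (openConn o a ∩ ⋂ t ∈ T.filter (fun t => r t < r a), (openConn o t)ᶜ : Set (BondConfig (Fin n))))
    (F : Set (Fin n) → ℝ) (hF : ∀ S S' : Set (Fin n), S ⊆ S' → F S ≤ F S')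
    (hcompat : ∀ b ∈ T, ∀ b' ∈ T, r b < r b' →
      ∫ ω, F (openCluster ω b) ∂(prodBernoulli w) < ∫ ω, F (openCluster ω b') ∂(prodBernoulli w)) :
    0 < s5dMargin w T r [] o v F := by
  have hG : ∀ S S' : Set (Fin n), S ⊆ S' →
      (fun S : Set (Fin n) => if x₁ ∈ S then (1 : ℝ) else 0) S ≤ (fun S : Set (Fin n) => if x₁ ∈ S then (1 : ℝ) else 0) S' := by
    intro S S' hSS'
    simp only
    by_cases h : x₁ ∈ S
    · rw [if_pos h, if_pos (hSS' h)]
    · rw [if_neg h]; split_ifs <;> norm_num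
  exact s5dMargin_nil_pos_of_strictCompat_of_neg w T o v F _ r hvT hF hG hr hcompat hpos
    (s5dMargin_nil_connFun_firstRelay_neg w T r x₁ hx hmin o v hvT hpos a ha hax hm hstrict)

end CSH

end Summit.CriticalPhenomena.PercolationContinuityZ3.Theorems

end
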